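import Mathlib
import Literature.Barriers.ValiantsHypothesis.CKRST20NaturalProofsExist
import HarnessLib

/-!
# Item `BarrierLever.NaturalProofsSeparateVNP` (stmt-ValiantsHypothesis-18972), SIGN SLICE —
# part 12: the coefficient formula of Valiant's Boolean sum (CKRST 2020 Lemma 19, discharged)

Discharges the parametrised named fact `Literature.Barriers.ValiantsHypothesis.CKRST2020_lemma19`
(Chatterjee–Kumar–Ramya–Saptharishi–Tengse 2020, v2 Lemma 19 = ECCC Lemma 5.6, typed by the cell
val-lit in `CKRST20NaturalProofsExist.lean`): for `g ∈ F[x ⊕ w]` (`x = x_1..x_n`, `w = w_1..w_m`) and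
an exponent vector `e` in the `x` variables,

  `coeff_e (boolSum g) = Σ_{ν ∈ supp g, ν_x = e} 2^{m - |supp ν_w|} · coeff_ν g`,

because `Σ_{α ∈ {0,1}^m} α^{ν_w} = #{α : α_j = 1 on supp ν_w} = 2^{m - |supp ν_w|}`. This is the
linear map `L_{n,d,s}` behind the parametrisation of `VNP` slices (CKRST Lemma 20 / Thm. 1.3).

* `BoolSumCoeff.ckrst2020_lemma19_holds (F) : CKRST2020_lemma19 F` (any commutative semiring).

References: [ChatterjeeKumarRamyaSaptharishiTengse2020] Lemma 5.6 (ECCC) = v2 Lemma 19;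
[Valiant1979] (the Boolean sum, tree `boolSum`).
-/

-- layout Summits/ValiantsHypothesis/ValiantsHypothesis forces the duplicated namespace component
set_option linter.dupNamespace false

namespace Summit.ValiantsHypothesis.ValiantsHypothesis.Theorems.BarrierLever.NaturalProofsSeparateVNP

open Literature.Barriers.ValiantsHypothesis Literature.Computability.AlgebraicComplexity MvPolynomial

namespace BoolSumCoeff

variable {F : Type*} [CommSemiring F] {n m : ℕ}

/-- The `w`-part of the substitution `α`: `∏_j (if α_j then 1 else 0)^{ν_j}` is `1` if `α_j` holds on
the support of `ν`, and `0` otherwise. [cite: ChatterjeeKumarRamyaSaptharishiTengse2020, Lemma 5.6 (ECCC)] -/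
theorem prod_ite_pow (α : Fin m → Bool) (ν : Fin m →₀ ℕ) :
    (∏ j, ((if α j then (1 : MvPolynomial (Fin n) F) else 0) ^ ν j)) =
      if ∀ j ∈ ν.support, α j = true then 1 else 0 := by
  classical
  split_ifs with h
  · refine Finset.prod_eq_one fun j _ => ?_
    by_cases hj : ν j = 0
    · rw [hj, pow_zero]
    · rw [h j (Finsupp.mem_support_iff.mpr hj), if_pos rfl, one_pow]
  · push Not at h
    obtain ⟨j, hj, hαj⟩ := h
    refine Finset.prod_eq_zero (Finset.mem_univ j) ?_
    rw [if_neg (by simpa using hαj), zero_pow (Finsupp.mem_support_iff.mp hj)]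

/-- The substitution `x ↦ x`, `w ↦ α` applied to `g`, coefficientwise: `coeff_e g(x, α) =
Σ_{ν ∈ supp g, ν_x = e, α = 1 on supp ν_w} coeff_ν g`. [cite: ChatterjeeKumarRamyaSaptharishiTengse2020, Lemma 5.6 (ECCC)] -/
theorem coeff_aeval_boolPoint (g : MvPolynomial (Fin n ⊕ Fin m) F) (α : Fin m → Bool)
    (e : Fin n →₀ ℕ) :
    coeff e (aeval (Sum.elim X fun j => if α j then (1 : MvPolynomial (Fin n) F) else 0) g) =
      ∑ ν ∈ g.support, if (Finsupp.sumFinsuppEquivProdFinsupp ν).1 = e then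
        (if ∀ j ∈ (Finsupp.sumFinsuppEquivProdFinsupp ν).2.support, α j = true then coeff ν g else 0)
        else 0 := by
  classical
  rw [MvPolynomial.aeval_def, eval₂_eq', coeff_sum]
  refine Finset.sum_congr rfl fun ν _ => ?_
  rw [Fintype.prod_sum_type]
  simp only [Sum.elim_inl, Sum.elim_inr]
  -- the `x`-part is the monomial `x^{ν_x}`
  have hx : (∏ a : Fin n, (X a : MvPolynomial (Fin n) F) ^ ν (Sum.inl a)) =
      monomial (Finsupp.sumFinsuppEquivProdFinsupp ν).1 1 := by
    rw [monomial_eq, C_1, one_mul, Finsupp.prod_pow]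
    exact Finset.prod_congr rfl fun a _ => by rw [Finsupp.fst_sumFinsuppEquivProdFinsupp]
  -- the `w`-part is an indicator
  have hw : (∏ j : Fin m, ((if α j then (1 : MvPolynomial (Fin n) F) else 0) ^ ν (Sum.inr j))) =
      if ∀ j ∈ (Finsupp.sumFinsuppEquivProdFinsupp ν).2.support, α j = true then 1 else 0 := by
    rw [← prod_ite_pow α (Finsupp.sumFinsuppEquivProdFinsupp ν).2]
    exact Finset.prod_congr rfl fun j _ => by rw [Finsupp.snd_sumFinsuppEquivProdFinsupp]
  rw [hx, hw, MvPolynomial.algebraMap_eq]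
  by_cases hP : ∀ j ∈ (Finsupp.sumFinsuppEquivProdFinsupp ν).2.support, α j = true
  · simp only [if_pos hP, mul_one, coeff_C_mul, coeff_monomial, mul_ite, mul_zero]
  · simp only [if_neg hP, mul_zero, coeff_zero]
    split_ifs <;> rfl

/-- `#{α ∈ {0,1}^m : α_j = 1 for j ∈ S} = 2^{m - |S|}`. [folklore] -/
theorem card_filter_forall_mem (S : Finset (Fin m)) :
    (Finset.univ.filter fun α : Fin m → Bool => ∀ j ∈ S, α j = true).card = 2 ^ (m - S.card) := by
  classical
  -- restriction to the complement of `S` is a bijection onto `Sᶜ → Bool`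
  let res : {α : Fin m → Bool // ∀ j ∈ S, α j = true} → ((↥(Sᶜ : Finset (Fin m))) → Bool) :=
    fun α j => α.1 j
  have hres : Function.Bijective res := by
    constructor
    · intro α β h
      apply Subtype.ext
      funext j
      by_cases hj : j ∈ S
      · rw [α.2 j hj, β.2 j hj]
      · have := congrFun h ⟨j, Finset.mem_compl.mpr hj⟩
        simpa [res] using this
    · intro γ
      refine ⟨⟨fun j => if hj : j ∈ S then true else γ ⟨j, Finset.mem_compl.mpr hj⟩,
        fun j hj => by simp [hj]⟩, ?_⟩
      funext j
      have hj : (j : Fin m) ∉ S := Finset.mem_compl.mp j.2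
      simp [res, hj]
  have h1 : (Finset.univ.filter fun α : Fin m → Bool => ∀ j ∈ S, α j = true).card =
      Fintype.card {α : Fin m → Bool // ∀ j ∈ S, α j = true} := by
    rw [Fintype.card_subtype]
  rw [h1, Fintype.card_of_bijective hres, Fintype.card_fun, Fintype.card_bool, Fintype.card_coe,
    Finset.card_compl, Fintype.card_fin]

/-- **CKRST 2020 Lemma 19 (ECCC Lemma 5.6) holds**: the coefficient formula of the Boolean sum,
`coeff_e (boolSum g) = Σ_{ν ∈ supp g, ν_x = e} 2^{m - |supp ν_w|} · coeff_ν g`, over any commutative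
semiring. [cite: ChatterjeeKumarRamyaSaptharishiTengse2020, Lemma 5.6 (ECCC) = v2 Lemma 19] -/
theorem ckrst2020_lemma19_holds (F : Type*) [CommSemiring F] : CKRST2020_lemma19 F := by
  intro n m g e
  classical
  unfold boolSum
  rw [coeff_sum]
  rw [Finset.sum_congr rfl fun α _ => coeff_aeval_boolPoint g α e, Finset.sum_comm]
  refine Finset.sum_congr rfl fun ν _ => ?_
  split_ifs with h1
  · rw [Finset.sum_ite, Finset.sum_const_zero, add_zero, Finset.sum_const, card_filter_forall_mem,
      nsmul_eq_mul, Nat.cast_pow, Nat.cast_ofNat]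
  · simp

end BoolSumCoeff

end Summit.ValiantsHypothesis.ValiantsHypothesis.Theorems.BarrierLever.NaturalProofsSeparateVNP
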